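import Summits.KontsevichZagierPeriods.KontsevichZagierPeriods.Theses.FermatIsogeny
import Literature.NumberTheory.Transcendental.KZBetaChains
import Literature.NumberTheory.Transcendental.KZRelationsLE
import Literature.NumberTheory.Transcendental.KZLogCalculusProofs
import Literature.Analysis.SpecialFunctions.SelbergIntegralBasic

/-!
# `BetaLinearSector` (stmt-KontsevichZagierPeriods-3897, route FermatIsogeny, crux rank 3) — birth skeleton

Crux: Conjecture 1 of Kontsevich–Zagier on the beta-LINEAR sector, all levels at once — for positive
rationals `a b a' b'` and a real algebraic `c`, two one-dimensional representations pinned on `(0,1)` as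
`[t^{a-1}(1-t)^{b-1}]` and `[c · t^{a'-1}(1-t)^{b'-1}]` with the same value are KZ-equivalent.

Line ("level reduction + Wolfart–Wüstholz + Koblitz–Rohrlich realisation"), two registered stubs, both
stated AT LEVEL `N` (exponents in the fundamental square `(0,1]²`, i.e. Koblitz–Rohrlich data
`0 < r, s ≤ N`) and with algebraic constants on BOTH sides:

* `stub_wolfartWustholz` — TRANSCENDENCE INPUT (which proportionalities exist). If
  `c·B(a,b) = c'·B(a',b')` with `c ≠ 0`, `c, c'` real algebraic, then the two pairs have the same
  Deligne–Koblitz–Ogus HODGE VECTOR: for every integer `h` prime to all denominators,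
  `{ha} + {hb} − {h(a+b)} = {ha'} + {hb'} − {h(a'+b')}` (`{·}` = fractional part). For generic pairs
  (`a, b, a+b ∉ ℤ`) this says `H_{a,b} = H_{a',b'}` for the Koblitz–Rohrlich CM types
  `H_{a,b} = {h ∈ (ℤ/N)ˣ : {ha} + {hb} < 1}`; for degenerate pairs it encodes Lindemann (`π ∉ ℚ̄`),
  Schneider 1941 (`B(a,b) ∉ ℚ̄`) and `B(a,b)/π ∉ ℚ̄`. It is exactly "the only ℚ̄-linear relations among
  `B(a,b)`, `(a,b) ∈ ℚ²`, are those that follow from the Deligne–Koblitz–Ogus relations"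
  (Wolfart–Wüstholz 1985, via Wüstholz's analytic subgroup theorem; Huber–Wüstholz 2022 for all
  1-periods). Pure number theory: no representation, no move.
* `stub_koblitzRohrlichRealisation` — GEOMETRIC REALISATION (the H21-specific content of the crux).
  Two level-`N` pinned beta representations with the SAME Hodge vector and the same value are
  KZ-equivalent: every Koblitz–Rohrlich coincidence (obvious ones: `S₃` and reflection pairs; non-obvious
  ones: the isogenies of K–R Thms 3–4 and the cross-level quotient maps `F_{MN} → F_N`) is realised by an
  explicit correspondence whose action compiles into moves (sheets = rule 2, exact algebraic forms =
  rule 3, Green on planar cells). Implied by the crux (scale by `c⁻¹`), so it carries no falsity risk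
  beyond the crux itself; its first non-obvious instance is the route's rank-2 item `IsogenyLinearNinth`.

Composition `BetaLinearSector_of_subs : stub₁-sig → stub₂-sig → (BetaLinearSector unfolded verbatim)`
(sorry-free, ≈ 200 lines), and `BetaLinearSector_of : BetaLinearSector` fed by the two stubs by name:
LEVEL REDUCTION inside the calculus — every pinned beta representation with an exponent `> 1` is moved
to level `N` by the PROVED translation chain `KZ.betaTranslation_equivalent` (integration by parts =
one Newton–Leibniz move with the algebraic primitive `t^a(1-t)^b` + one additivity move; file
`Literature/…/KZBetaChains.lean`) and the PROVED reflection `KZ.betaReflection_equivalent` (`t ↦ 1−t`),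
transported through real algebraic scalars (`KZ.IntegralRep.constMul`, `KZ.Equivalent.constMul`) and
congruence on the domain (`KZ.of_sub_of_mem_relations_of_eqOn`), by strong induction on
`⌊a⌋ + ⌊b⌋`; values follow the chain by soundness (`KZ.Equivalent.value_eq_holds`) and are computed
at the bottom (`∫_{(0,1)} t^{a-1}(1-t)^{b-1} = Γ(a)Γ(b)/Γ(a+b)`, Selberg file); the degenerate
constant `c = 0` is settled inside the assembly (both representations are then zero on their domain,
`KZ.of_mem_relations_of_eqOn_zero`); the two stubs are fed in at level `N` only.

Disproof used: none on file for this crux (no `Cruxes/BetaLinearSector/Disproof.lean`, no dead lines,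
`ledger negatives --problem KontsevichZagierPeriods` has no statement about beta-linear pairs).
All statements are over existing declarations only (`Literature.NumberTheory.Transcendental.KZ.*`,
Mathlib's `Real.Gamma`, `Int.fract`, `IsCoprime`, `Rat.den`).
-/

noncomputable section

set_option linter.dupNamespace false

namespace Summit.KontsevichZagierPeriods.KontsevichZagierPeriods.Cruxes.BetaLinearSector.Birth

open MeasureTheory Set
open Literature.NumberTheory.Transcendental
open Literature.NumberTheory.Transcendental.KZ
open Summit.KontsevichZagierPeriods.KontsevichZagierPeriods.Theses.FermatIsogeny (BetaLinearSector)

/-! ## The two registered stubs -/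

/-- Stub 1 (TRANSCENDENCE INPUT, Wolfart–Wüstholz at level `N`): a ℚ̄-linear relation
`c·B(a,b) = c'·B(a',b')` (`c ≠ 0`; exponents in the fundamental square `(0,1]`) forces the two pairs to
have the same Deligne–Koblitz–Ogus Hodge vector `h ↦ {ha} + {hb} − {h(a+b)}` on the units `h`
(integers prime to every denominator). Sources: WolfartWustholz1985 (doi:10.1007/bf01455911),
HuberWustholz2022 (1-periods), KoblitzRohrlich1978 p.1184, Deligne1982HodgeCycles §7 (Koblitz–Ogus
appendix), Schneider 1941, Lindemann 1882. Size XL in Lean (analytic subgroup theorem); a published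
theorem on paper. -/
theorem stub_wolfartWustholz :
    ∀ (a b a' b' : ℚ) (c c' : ℝ),
      0 < a → a ≤ 1 → 0 < b → b ≤ 1 → 0 < a' → a' ≤ 1 → 0 < b' → b' ≤ 1 →
      IsAlgebraic ℚ c → IsAlgebraic ℚ c' → c ≠ 0 →
      c * (Real.Gamma (a:ℝ) * Real.Gamma (b:ℝ) / Real.Gamma ((a:ℝ) + (b:ℝ))) =
        c' * (Real.Gamma (a':ℝ) * Real.Gamma (b':ℝ) / Real.Gamma ((a':ℝ) + (b':ℝ))) →
      ∀ h : ℤ, IsCoprime h (a.den : ℤ) → IsCoprime h (b.den : ℤ) → IsCoprime h (a'.den : ℤ) →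
        IsCoprime h (b'.den : ℤ) →
        Int.fract ((h:ℚ) * a) + Int.fract ((h:ℚ) * b) - Int.fract ((h:ℚ) * (a + b)) =
          Int.fract ((h:ℚ) * a') + Int.fract ((h:ℚ) * b') - Int.fract ((h:ℚ) * (a' + b')) := by
  sorry

/-- Stub 2 (GEOMETRIC REALISATION, Koblitz–Rohrlich correspondences compiled into moves, at level `N`):
two one-dimensional representations pinned on `(0,1)` as `[c · t^{a-1}(1-t)^{b-1}]` and
`[c' · t^{a'-1}(1-t)^{b'-1}]` (exponents in `(0,1]`, `c ≠ 0`, `c, c'` real algebraic) with the SAME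
Hodge vector and the same value are KZ-equivalent. Implied by the crux; its content is that every K–R
coincidence `H_{r,s,t} = H_{r',s',t'}` (K–R Thms 1–4, incl. the infinite families at `N = 3ⁿ, 2ⁿ` and the
cross-level quotients) is the shadow of an explicit correspondence on `F_N × F_{N'}` whose action on the
real arcs compiles into rules 1–3 (sheets, exact algebraic forms, Green on planar cells); the obvious
classes are automorphisms (rule 2) and Euler-reflection chains. Sources: KoblitzRohrlich1978 Thms 1–4,
Gross1978 (Rohrlich's appendix), Aoki1991, arXiv:1705.09248, KontsevichZagier2001 §1.2. Size XL. -/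
theorem stub_koblitzRohrlichRealisation :
    ∀ (a b a' b' : ℚ) (c c' : ℝ),
      0 < a → a ≤ 1 → 0 < b → b ≤ 1 → 0 < a' → a' ≤ 1 → 0 < b' → b' ≤ 1 →
      IsAlgebraic ℚ c → IsAlgebraic ℚ c' → c ≠ 0 →
      (∀ h : ℤ, IsCoprime h (a.den : ℤ) → IsCoprime h (b.den : ℤ) → IsCoprime h (a'.den : ℤ) →
        IsCoprime h (b'.den : ℤ) →
        Int.fract ((h:ℚ) * a) + Int.fract ((h:ℚ) * b) - Int.fract ((h:ℚ) * (a + b)) =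
          Int.fract ((h:ℚ) * a') + Int.fract ((h:ℚ) * b') - Int.fract ((h:ℚ) * (a' + b'))) →
      ∀ (r r' : Literature.NumberTheory.Transcendental.KZ.IntegralRep 1),
        r.domain = {x | x 0 ∈ Set.Ioo (0:ℝ) 1} →
        Set.EqOn r.integrand (fun x => c * (x 0) ^ ((a:ℝ) - 1) * (1 - x 0) ^ ((b:ℝ) - 1)) r.domain →
        r'.domain = {x | x 0 ∈ Set.Ioo (0:ℝ) 1} →
        Set.EqOn r'.integrand (fun x => c' * (x 0) ^ ((a':ℝ) - 1) * (1 - x 0) ^ ((b':ℝ) - 1))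
          r'.domain →
        r.value = r'.value →
        Literature.NumberTheory.Transcendental.KZ.Equivalent r r' := by
  sorry

/-! ## The composition (sorry-free): level reduction inside the calculus -/

set_option quotPrecheck false in
-- Shorthand for the statement of `stub_wolfartWustholz` (internal to the assembly).
local notation "SigWW" =>
  (∀ (a b a' b' : ℚ) (c c' : ℝ),
      0 < a → a ≤ 1 → 0 < b → b ≤ 1 → 0 < a' → a' ≤ 1 → 0 < b' → b' ≤ 1 →
      IsAlgebraic ℚ c → IsAlgebraic ℚ c' → c ≠ 0 →
      c * (Real.Gamma (a:ℝ) * Real.Gamma (b:ℝ) / Real.Gamma ((a:ℝ) + (b:ℝ))) =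
        c' * (Real.Gamma (a':ℝ) * Real.Gamma (b':ℝ) / Real.Gamma ((a':ℝ) + (b':ℝ))) →
      ∀ h : ℤ, IsCoprime h (a.den : ℤ) → IsCoprime h (b.den : ℤ) → IsCoprime h (a'.den : ℤ) →
        IsCoprime h (b'.den : ℤ) →
        Int.fract ((h:ℚ) * a) + Int.fract ((h:ℚ) * b) - Int.fract ((h:ℚ) * (a + b)) =
          Int.fract ((h:ℚ) * a') + Int.fract ((h:ℚ) * b') - Int.fract ((h:ℚ) * (a' + b')))

set_option quotPrecheck false in
-- Shorthand for the statement of `stub_koblitzRohrlichRealisation` (internal to the assembly).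
local notation "SigKR" =>
  (∀ (a b a' b' : ℚ) (c c' : ℝ),
      0 < a → a ≤ 1 → 0 < b → b ≤ 1 → 0 < a' → a' ≤ 1 → 0 < b' → b' ≤ 1 →
      IsAlgebraic ℚ c → IsAlgebraic ℚ c' → c ≠ 0 →
      (∀ h : ℤ, IsCoprime h (a.den : ℤ) → IsCoprime h (b.den : ℤ) → IsCoprime h (a'.den : ℤ) →
        IsCoprime h (b'.den : ℤ) →
        Int.fract ((h:ℚ) * a) + Int.fract ((h:ℚ) * b) - Int.fract ((h:ℚ) * (a + b)) =
          Int.fract ((h:ℚ) * a') + Int.fract ((h:ℚ) * b') - Int.fract ((h:ℚ) * (a' + b'))) →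
      ∀ (r r' : Literature.NumberTheory.Transcendental.KZ.IntegralRep 1),
        r.domain = {x | x 0 ∈ Set.Ioo (0:ℝ) 1} →
        Set.EqOn r.integrand (fun x => c * (x 0) ^ ((a:ℝ) - 1) * (1 - x 0) ^ ((b:ℝ) - 1)) r.domain →
        r'.domain = {x | x 0 ∈ Set.Ioo (0:ℝ) 1} →
        Set.EqOn r'.integrand (fun x => c' * (x 0) ^ ((a':ℝ) - 1) * (1 - x 0) ^ ((b':ℝ) - 1))
          r'.domain →
        r.value = r'.value →
        Literature.NumberTheory.Transcendental.KZ.Equivalent r r')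

/-- `r` is PINNED as `[(0,1), c · t^{a-1}(1-t)^{b-1}]` (the two hypotheses on each representation in
the crux, with a constant). [folklore] -/
def Pinned (c : ℝ) (a b : ℚ) (r : IntegralRep 1) : Prop :=
  r.domain = {x | x 0 ∈ Set.Ioo (0:ℝ) 1} ∧
    EqOn r.integrand (fun x => c * (x 0) ^ ((a:ℝ) - 1) * (1 - x 0) ^ ((b:ℝ) - 1)) r.domain

/-- Existence of pinned beta representations for every real algebraic constant and positive rational
exponents (semialgebraic Euler–Mellin integrand, absolute convergence of the Beta integral). [folklore] -/
theorem exists_pinned (c : ℝ) (hc : IsAlgebraic ℚ c) {a b : ℚ} (ha : 0 < a) (hb : 0 < b) :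
    ∃ r : IntegralRep 1, Pinned c a b r := by
  have haR : (0:ℝ) < a := by exact_mod_cast ha
  have hbR : (0:ℝ) < b := by exact_mod_cast hb
  set g : ℝ → ℝ := fun t => t ^ ((a:ℝ) - 1) * (1 - t) ^ ((b:ℝ) - 1) with hg
  have hint : IntegrableOn (fun x : Fin 1 → ℝ => g (x 0)) {x | x 0 ∈ Set.Ioo (0:ℝ) 1} :=
    integrableOn_setOf_apply_mem_iff.2
      (Literature.Analysis.SpecialFunctions.Selberg.integrableOn_Ioo_rpow_mul_one_sub_rpow_and_integral_eq
        haR hbR).1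
  have hsa : IsSemialgebraicFunOn ℚ {x : Fin 1 → ℝ | x 0 ∈ Set.Ioo (0:ℝ) 1}
      (fun x : Fin 1 → ℝ => g (x 0)) :=
    (isSemialgebraicFunOn_const_mul_rpow_mul_rpow 1 (a - 1) (b - 1)).congr fun x _ => by
      simp only [hg, Rat.cast_one, one_mul, Rat.cast_sub]
  let r₀ : IntegralRep 1 := ⟨_, _, BallPeeling.isSemialgebraic_posIoo, hsa, hint⟩
  refine ⟨r₀.constMul c hc, rfl, fun x _ => ?_⟩
  simp only [IntegralRep.integrand_constMul, r₀, hg, mul_assoc]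

/-- The value of a pinned representation is `c · B(a,b) = c · Γ(a)Γ(b)/Γ(a+b)`. [folklore] -/
theorem value_of_pinned {c : ℝ} {a b : ℚ} {r : IntegralRep 1} (h : Pinned c a b r)
    (ha : 0 < a) (hb : 0 < b) :
    r.value = c * (Real.Gamma (a:ℝ) * Real.Gamma (b:ℝ) / Real.Gamma ((a:ℝ) + (b:ℝ))) := by
  obtain ⟨hd, hi⟩ := h
  have haR : (0:ℝ) < a := by exact_mod_cast ha
  have hbR : (0:ℝ) < b := by exact_mod_cast hb
  rw [IntegralRep.value, setIntegral_congr_fun (IntegralRep.measurableSet_domain_holds r) hi, hd]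
  have h1 := (volume_preserving_funUnique (Fin 1) ℝ).setIntegral_preimage_emb
    (MeasurableEquiv.funUnique (Fin 1) ℝ).measurableEmbedding
    (fun t : ℝ => c * t ^ ((a:ℝ) - 1) * (1 - t) ^ ((b:ℝ) - 1)) (Ioo (0:ℝ) 1)
  have h2 : ∫ t in Ioo (0:ℝ) 1, c * t ^ ((a:ℝ) - 1) * (1 - t) ^ ((b:ℝ) - 1) =
      c * (Real.Gamma (a:ℝ) * Real.Gamma (b:ℝ) / Real.Gamma ((a:ℝ) + (b:ℝ))) := by
    rw [← (Literature.Analysis.SpecialFunctions.Selberg.integrableOn_Ioo_rpow_mul_one_sub_rpow_and_integral_eq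
      haR hbR).2, ← integral_const_mul]
    congr 1
    funext t
    ring
  rw [← h2, ← h1]
  rfl

/-- A pinned representation is KZ-equivalent to the scaling by `k` of a representation pinned with the
same exponents and constant `c₀`, as soon as `c = k c₀` (congruence on the domain). [folklore] -/
theorem equivalent_constMul_of_pinned {c c₀ k : ℝ} (hk : IsAlgebraic ℚ k) {a b : ℚ}
    {r T : IntegralRep 1} (hr : Pinned c a b r) (hT : Pinned c₀ a b T) (hck : c = k * c₀) :
    Equivalent r (T.constMul k hk) :=
  of_sub_of_mem_relations_of_eqOn (by rw [IntegralRep.domain_constMul, hT.1, hr.1]) fun x hx => by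
    have hxT : x ∈ T.domain := by rw [hT.1, ← hr.1]; exact hx
    rw [hr.2 hx, IntegralRep.integrand_constMul]
    dsimp only
    rw [hT.2 hxT, hck]
    ring

/-- REFLECTION with constants: `[c·t^{a-1}(1-t)^{b-1}] ∼ [c·t^{b-1}(1-t)^{a-1}]` (one change of
variables `t ↦ 1 − t`, `KZ.betaReflection_equivalent`, transported through the scalar `c`).
[cite: KontsevichZagier2001, §1.2 rule (2)] -/
theorem pinned_swap {c : ℝ} (hc : IsAlgebraic ℚ c) {a b : ℚ} (ha : 0 < a) (hb : 0 < b)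
    {r ρ : IntegralRep 1} (hr : Pinned c a b r) (hρ : Pinned c b a ρ) : Equivalent r ρ := by
  obtain ⟨T, hT⟩ := exists_pinned 1 isAlgebraic_one ha hb
  obtain ⟨T', hT'⟩ := exists_pinned 1 isAlgebraic_one hb ha
  have h : Equivalent T T' :=
    betaReflection_equivalent ((a:ℝ) - 1) ((b:ℝ) - 1) T T' hT.1
      (fun x hx => by simp only [hT.2 hx, one_mul]) hT'.1 (fun x hx => by simp only [hT'.2 hx, one_mul])
  have e₁ : Equivalent r (T.constMul c hc) := equivalent_constMul_of_pinned hc hr hT (mul_one c).symm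
  have e₂ : Equivalent ρ (T'.constMul c hc) := equivalent_constMul_of_pinned hc hρ hT' (mul_one c).symm
  exact e₁.trans ((h.constMul c hc).trans e₂.symm)

/-- TRANSLATION with constants (integration by parts inside the rules, `KZ.betaTranslation_equivalent`
transported through scalars): `[c·t^{a-1}(1-t)^{b}] ∼ [(c b/(a+b))·t^{a-1}(1-t)^{b-1}]`, the value
identity `c·B(a,b+1) = (c b/(a+b))·B(a,b)`. [cite: AndrewsAskeyRoy1999, §1.1] -/
theorem pinned_translate {c : ℝ} (hc : IsAlgebraic ℚ c) {a b : ℚ} (ha : 0 < a) (hb : 0 < b)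
    {r ρ : IntegralRep 1} (hr : Pinned c a (b + 1) r)
    (hρ : Pinned (c * ((b / (a + b) : ℚ) : ℝ)) a b ρ) : Equivalent r ρ := by
  have hab : (0:ℝ) < (a:ℝ) + (b:ℝ) := by
    have haR : (0:ℝ) < a := by exact_mod_cast ha
    have hbR : (0:ℝ) < b := by exact_mod_cast hb
    linarith
  obtain ⟨T₁, hT₁⟩ := exists_pinned (((a + b : ℚ)) : ℝ) (isAlgebraic_rat ℚ (a + b)) ha
    (by linarith : 0 < b + 1)
  obtain ⟨T₂, hT₂⟩ := exists_pinned ((b : ℚ) : ℝ) (isAlgebraic_rat ℚ b) ha hb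
  have h12 : Equivalent T₁ T₂ := by
    refine betaTranslation_equivalent a b ha hb T₁ T₂ hT₁.1 (fun x hx => ?_) hT₂.1 (fun x hx => ?_)
    · simp only [hT₁.2 hx, Rat.cast_add, Rat.cast_one, add_sub_cancel_right]
      ring
    · simp only [hT₂.2 hx]
      ring
  set k : ℝ := c * (((1 / (a + b) : ℚ)) : ℝ) with hk_def
  have hk : IsAlgebraic ℚ k := hc.mul (isAlgebraic_rat ℚ _)
  have e₁ : Equivalent r (T₁.constMul k hk) := by
    refine equivalent_constMul_of_pinned hk hr hT₁ ?_
    rw [hk_def]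
    push_cast
    field_simp
  have e₂ : Equivalent ρ (T₂.constMul k hk) := by
    refine equivalent_constMul_of_pinned hk hρ hT₂ ?_
    rw [hk_def]
    push_cast
    ring
  exact e₁.trans ((h12.constMul k hk).trans e₂.symm)

/-- The two-sided, constant-carrying form of the crux for fixed exponents: any two representations
pinned as `[c·β(a,b)]`, `[c'·β(a',b')]` (`c, c'` real algebraic) with equal values are KZ-equivalent.
[folklore] -/
def P (a b a' b' : ℚ) : Prop :=
  ∀ (c c' : ℝ) (r r' : IntegralRep 1), IsAlgebraic ℚ c → IsAlgebraic ℚ c' →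
    Pinned c a b r → Pinned c' a' b' r' → r.value = r'.value → Equivalent r r'

theorem P.symm {a b a' b' : ℚ} (h : P a b a' b') : P a' b' a b :=
  fun c c' r r' hc hc' hr hr' hv => (h c' c r' r hc' hc hr' hr hv.symm).symm

/-- Swapping the exponents on the left (reflection move + soundness). [folklore] -/
theorem P.swap_left {a b a' b' : ℚ} (ha : 0 < a) (hb : 0 < b) (h : P b a a' b') : P a b a' b' := by
  intro c c' r r' hc hc' hr hr' hv
  obtain ⟨ρ, hρ⟩ := exists_pinned c hc hb ha
  have e : Equivalent r ρ := pinned_swap hc ha hb hr hρ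
  have hv' : ρ.value = r'.value := (Equivalent.value_eq_holds e).symm.trans hv
  exact e.trans (h c c' ρ r' hc hc' hρ hr' hv')

/-- Lowering the second exponent on the left by one (translation move + soundness). [folklore] -/
theorem P.lower_left {a b a' b' : ℚ} (ha : 0 < a) (hb : 0 < b) (h : P a b a' b') :
    P a (b + 1) a' b' := by
  intro c c' r r' hc hc' hr hr' hv
  have hk : IsAlgebraic ℚ (c * ((b / (a + b) : ℚ) : ℝ)) := hc.mul (isAlgebraic_rat ℚ _)
  obtain ⟨ρ, hρ⟩ := exists_pinned _ hk ha hb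
  have e : Equivalent r ρ := pinned_translate hc ha hb hr hρ
  have hv' : ρ.value = r'.value := (Equivalent.value_eq_holds e).symm.trans hv
  exact e.trans (h _ c' ρ r' hk hc' hρ hr' hv')

/-- LEVEL REDUCTION on the left pair: if `P a₀ b₀ a' b'` holds for all exponents `a₀, b₀ ∈ (0,1]`, it
holds for all positive rational `a, b` (strong induction on `⌊a⌋ + ⌊b⌋`, translating and swapping).
[folklore] -/
theorem P.of_base_left {a' b' : ℚ}
    (base : ∀ a b : ℚ, 0 < a → a ≤ 1 → 0 < b → b ≤ 1 → P a b a' b') :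
    ∀ a b : ℚ, 0 < a → 0 < b → P a b a' b' := by
  suffices H : ∀ n : ℕ, ∀ a b : ℚ, ⌊a⌋₊ + ⌊b⌋₊ = n → 0 < a → 0 < b → P a b a' b' from
    fun a b ha hb => H _ a b rfl ha hb
  intro n
  induction n using Nat.strong_induction_on with
  | _ n ih =>
    intro a b hn ha hb
    by_cases hb1 : b ≤ 1
    · by_cases ha1 : a ≤ 1
      · exact base a b ha ha1 hb hb1
      · push Not at ha1
        have ha' : 0 < a - 1 := by linarith
        have hfl : ⌊a⌋₊ = ⌊a - 1⌋₊ + 1 := by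
          conv_lhs => rw [← sub_add_cancel a 1]
          exact Nat.floor_add_one ha'.le
        have hlt : ⌊b⌋₊ + ⌊a - 1⌋₊ < n := by omega
        have hP : P b (a - 1) a' b' := ih _ hlt b (a - 1) rfl hb ha'
        have hP' : P b a a' b' := by simpa using hP.lower_left hb ha'
        exact hP'.swap_left ha hb
    · push Not at hb1
      have hb' : 0 < b - 1 := by linarith
      have hfl : ⌊b⌋₊ = ⌊b - 1⌋₊ + 1 := by
        conv_lhs => rw [← sub_add_cancel b 1]
        exact Nat.floor_add_one hb'.le
      have hlt : ⌊a⌋₊ + ⌊b - 1⌋₊ < n := by omega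
      have hP : P a (b - 1) a' b' := ih _ hlt a (b - 1) rfl ha hb'
      simpa using hP.lower_left ha hb'

/-- THE LEVEL-`N` CASE from the two stubs: exponents in `(0,1]`; values computed, the degenerate constant
`c = 0` settled by hand (both representations vanish on their domain), otherwise Wolfart–Wüstholz gives
the common Hodge vector and Koblitz–Rohrlich realisation the chain of moves. [folklore] -/
theorem P.base (hWW : SigWW) (hKR : SigKR) {a b a' b' : ℚ} (ha : 0 < a) (ha1 : a ≤ 1) (hb : 0 < b)
    (hb1 : b ≤ 1) (ha' : 0 < a') (ha1' : a' ≤ 1) (hb' : 0 < b') (hb1' : b' ≤ 1) : P a b a' b' := by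
  intro c c' r r' hc hc' hr hr' hv
  have hvr := value_of_pinned hr ha hb
  have hvr' := value_of_pinned hr' ha' hb'
  have haR' : (0:ℝ) < a' := by exact_mod_cast ha'
  have hbR' : (0:ℝ) < b' := by exact_mod_cast hb'
  have hB' : 0 < Real.Gamma (a':ℝ) * Real.Gamma (b':ℝ) / Real.Gamma ((a':ℝ) + (b':ℝ)) :=
    div_pos (mul_pos (Real.Gamma_pos_of_pos haR') (Real.Gamma_pos_of_pos hbR'))
      (Real.Gamma_pos_of_pos (by linarith))
  have heq : c * (Real.Gamma (a:ℝ) * Real.Gamma (b:ℝ) / Real.Gamma ((a:ℝ) + (b:ℝ))) =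
      c' * (Real.Gamma (a':ℝ) * Real.Gamma (b':ℝ) / Real.Gamma ((a':ℝ) + (b':ℝ))) := by
    rw [← hvr, ← hvr', hv]
  by_cases hc0 : c = 0
  · have hc'0 : c' = 0 := by
      have h0 : c' * (Real.Gamma (a':ℝ) * Real.Gamma (b':ℝ) / Real.Gamma ((a':ℝ) + (b':ℝ))) = 0 := by
        rw [← heq, hc0, zero_mul]
      exact (mul_eq_zero.1 h0).resolve_right hB'.ne'
    have h1 : of r ∈ relations := of_mem_relations_of_eqOn_zero r fun x hx => by
      rw [hr.2 hx]
      simp [hc0]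
    have h2 : of r' ∈ relations := of_mem_relations_of_eqOn_zero r' fun x hx => by
      rw [hr'.2 hx]
      simp [hc'0]
    exact relations.sub_mem h1 h2
  · have hε := hWW a b a' b' c c' ha ha1 hb hb1 ha' ha1' hb' hb1' hc hc' hc0 heq
    exact hKR a b a' b' c c' ha ha1 hb hb1 ha' ha1' hb' hb1' hc hc' hc0 hε r r' hr.1 hr.2 hr'.1 hr'.2 hv

/-- ALL LEVELS from the two stubs: reduce the right pair, then the left pair, to level `N`. [folklore] -/
theorem P.all (hWW : SigWW) (hKR : SigKR) {a b a' b' : ℚ} (ha : 0 < a) (hb : 0 < b) (ha' : 0 < a')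
    (hb' : 0 < b') : P a b a' b' := by
  refine P.of_base_left (fun a₀ b₀ ha₀ ha₀1 hb₀ hb₀1 => ?_) a b ha hb
  refine (P.of_base_left (a' := a₀) (b' := b₀) (fun a₁ b₁ ha₁ ha₁1 hb₁ hb₁1 => ?_) a' b' ha' hb').symm
  exact P.base hWW hKR ha₁ ha₁1 hb₁ hb₁1 ha₀ ha₀1 hb₀ hb₀1

/-- **The composition, arrow form**: Wolfart–Wüstholz at level `N` → Koblitz–Rohrlich realisation at
level `N` → the crux `BetaLinearSector` UNFOLDED VERBATIM (so that exactly one theorem of this file,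
`BetaLinearSector_of`, concludes the crux by its route name). Level reduction by the proved
translation/reflection chains, soundness, the Beta integral, the case `c = 0`. [folklore] -/
theorem BetaLinearSector_of_subs :
    (∀ (a b a' b' : ℚ) (c c' : ℝ),
      0 < a → a ≤ 1 → 0 < b → b ≤ 1 → 0 < a' → a' ≤ 1 → 0 < b' → b' ≤ 1 →
      IsAlgebraic ℚ c → IsAlgebraic ℚ c' → c ≠ 0 →
      c * (Real.Gamma (a:ℝ) * Real.Gamma (b:ℝ) / Real.Gamma ((a:ℝ) + (b:ℝ))) =
        c' * (Real.Gamma (a':ℝ) * Real.Gamma (b':ℝ) / Real.Gamma ((a':ℝ) + (b':ℝ))) →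
      ∀ h : ℤ, IsCoprime h (a.den : ℤ) → IsCoprime h (b.den : ℤ) → IsCoprime h (a'.den : ℤ) →
        IsCoprime h (b'.den : ℤ) →
        Int.fract ((h:ℚ) * a) + Int.fract ((h:ℚ) * b) - Int.fract ((h:ℚ) * (a + b)) =
          Int.fract ((h:ℚ) * a') + Int.fract ((h:ℚ) * b') - Int.fract ((h:ℚ) * (a' + b'))) →
    (∀ (a b a' b' : ℚ) (c c' : ℝ),
      0 < a → a ≤ 1 → 0 < b → b ≤ 1 → 0 < a' → a' ≤ 1 → 0 < b' → b' ≤ 1 →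
      IsAlgebraic ℚ c → IsAlgebraic ℚ c' → c ≠ 0 →
      (∀ h : ℤ, IsCoprime h (a.den : ℤ) → IsCoprime h (b.den : ℤ) → IsCoprime h (a'.den : ℤ) →
        IsCoprime h (b'.den : ℤ) →
        Int.fract ((h:ℚ) * a) + Int.fract ((h:ℚ) * b) - Int.fract ((h:ℚ) * (a + b)) =
          Int.fract ((h:ℚ) * a') + Int.fract ((h:ℚ) * b') - Int.fract ((h:ℚ) * (a' + b'))) →
      ∀ (r r' : Literature.NumberTheory.Transcendental.KZ.IntegralRep 1),
        r.domain = {x | x 0 ∈ Set.Ioo (0:ℝ) 1} →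
        Set.EqOn r.integrand (fun x => c * (x 0) ^ ((a:ℝ) - 1) * (1 - x 0) ^ ((b:ℝ) - 1)) r.domain →
        r'.domain = {x | x 0 ∈ Set.Ioo (0:ℝ) 1} →
        Set.EqOn r'.integrand (fun x => c' * (x 0) ^ ((a':ℝ) - 1) * (1 - x 0) ^ ((b':ℝ) - 1))
          r'.domain →
        r.value = r'.value →
        Literature.NumberTheory.Transcendental.KZ.Equivalent r r') →
    ∀ (a b a' b' : ℚ) (c : ℝ), 0 < a → 0 < b → 0 < a' → 0 < b' → IsAlgebraic ℚ c →
      ∀ (r r' : Literature.NumberTheory.Transcendental.KZ.IntegralRep 1),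
        r.domain = {x | x 0 ∈ Set.Ioo (0:ℝ) 1} →
        Set.EqOn r.integrand (fun x => (x 0) ^ ((a:ℝ) - 1) * (1 - x 0) ^ ((b:ℝ) - 1)) r.domain →
        r'.domain = {x | x 0 ∈ Set.Ioo (0:ℝ) 1} →
        Set.EqOn r'.integrand (fun x => c * (x 0) ^ ((a':ℝ) - 1) * (1 - x 0) ^ ((b':ℝ) - 1)) r'.domain →
        r.value = r'.value → Literature.NumberTheory.Transcendental.KZ.Equivalent r r' := by
  intro hWW hKR a b a' b' c ha hb ha' hb' hc r r' hd hi hd' hi' hv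
  refine P.all hWW hKR ha hb ha' hb' 1 c r r' isAlgebraic_one hc ⟨hd, fun x hx => ?_⟩ ⟨hd', hi'⟩ hv
  simp only [hi hx, one_mul]

/-- **Skeleton theorem** (concludes the crux BY NAME): `BetaLinearSector` from the two declared stubs,
through the sorry-free composition `BetaLinearSector_of_subs`. -/
theorem BetaLinearSector_of : BetaLinearSector :=
  BetaLinearSector_of_subs stub_wolfartWustholz stub_koblitzRohrlichRealisation

end Summit.KontsevichZagierPeriods.KontsevichZagierPeriods.Cruxes.BetaLinearSector.Birth
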